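import Summits.NavierStokesRegularity.OSWSelfSimilar.SheetRTimeShiftModeAssembly
import Summits.NavierStokesRegularity.OSWSelfSimilar.SheetRTranslationMode
import Summits.NavierStokesRegularity.OSWSelfSimilar.SheetRSpectrumCertifiedProfile
import HarnessLib

/-!
# SHEET-ℝ, EVEN half of Z3-SR-SPEC: items (PO-2) ∧ (PO-3) assembled — `σ = ½` is an exact eigenvalue of `−DG⁺(Ω)`
# (translation-covariant gauge) with eigenvector the translation mode `Ω′ ∈ E⁺₀`, for the certified-zero data shape
# AND for THE certified profile `Ω* = Ω̄ + prim (der δ)`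

HONEST FRAMING (cell ns-blowup GROUP B / zone Z3, case Z3-SR-SPEC EVEN half (SPEC-EVEN-R1), PREREG
`HOME/profile/cert/impl1/sheetR/spec/even/PREREG-Z3-SR-SPEC-EVEN.md` v1.1 84357d3d94388851 §P4 items PO-2 / PO-3, DESIGN
`DESIGN-Z3-SR-SPEC-EVEN.md` §2; profile-lead WORD (iq)(2) «P4 paper items as kernel files where they are calculus, 0 kit»;
1-D MODEL — the viscous gCLM / OSW sheet-ℝ profile equation `G(Ω) = Ω + ½ξΩ′ + a𝒰Ω·Ω′ − HΩ·Ω − νΩ″`; not Euler, not NS;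
«violates: none — MODEL»). Nothing here asserts that a profile exists: every theorem is an implication from a strong zero, an
`E`-weak zero, or the existence row's named hypotheses; NO number of any certificate moves.

THE EVEN TWIN of `SheetRTimeShiftModeAssembly.timeShiftMode_eigen_and_energy` (odd item (P6): `σ = 1`, T-shift mode `Ω + ½ξΩ′ ∈ E`).
The even record row `CertificateViscousSheetRSpectrumEven` (p526204) carries in its «NOT kernel-checked» sentence «PO-2 (`Ω*′ ∈ E⁺₀`) — PAPER;
PO-3 = KERNEL `SheetRTranslationMode`». Both inputs ARE tree theorems — PO-3 = cert-1's
`SheetRTranslationMode.linearised_translationMode_covariant` (pointwise `DG⁺(Ω)[Ω′] = −½Ω′` for a `C³` strong zero in the decay class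
`Ω ∈ L¹`, `|Ω″| ≤ M`, `|Ω′| ≤ C/(1+ξ²)`), PO-2 = cert-5's `SheetRTimeShiftModeAssembly.translationMode_mem_evenEnergyClass(_of_weakZero)`
(`Ω′` even, `∫(L²+ξ²)(Ω′² + Ω″²) < ∞`, `∫Ω′ = 0`) — and THIS FILE composes them, with the decay class DISCHARGED by
`SheetRTimeShiftModeAssembly.decayClass`, into ONE kernel sentence on three data shapes:
* §1 `translationMode_eigen_and_energy`: odd energy-class `C²` strong zero (`ν > 0`, `L > 0`) ⇒ with `v = Ω′`:
  `v + ½X·v′ + a·(HΩ·Ω′ + 𝒰Ω·v′) − Hv·Ω − HΩ·v − ν·v″ = −½·v` at every `X` (the translation-COVARIANT perturbation velocity of `Ω′` is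
  `𝒰_{Ω′} = ∫_{−∞}^X H[Ω′] = HΩ`, DESIGN (D2)) ∧ `v` even ∧ `∫(L²+ξ²)v² < ∞` ∧ `∫(L²+ξ²)v′² < ∞` ∧ `∫v = 0`; `translationMode_eigen_pinned`:
  the PINNED-gauge companion `… = −(½ + a·HΩ(0))·v` (the non-covariant artefact `1.28974` of DESIGN (D2), `linearised_translationMode_pinned`).
* §2 `translationMode_eigen_and_energy_of_weakZero`: the same on the certificate's literal `E`-weak zero `Ω = ∫₀Ω₁` (composition with the
  bridge `SheetRWeakToStrong` through the odd assembly), plus `translationMode_ne_zero_of_weakZero` (`Ω(X₀) ≠ 0 ⇒ Ω′ ≢ 0`).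
* §3 `translationMode_certified`: for THE certified profile of the Z3-SR chain — every `δ` in the `rEBR2`-ball solving the linearised weak
  equation at the centre (`SheetRCertificateAssemblyB.existsUnique_weakSolutionB`), `Ω* := Ω̄ + prim (der δ)`, `a = 1/5`, `ν = 1`, `L = 8` — via
  cert-2's `SheetRSpectrumCertifiedProfile.exists_isCentre_star` (Ω* is a centre, a weak zero against all tests, `Ω*(X₀) ≠ 0`): `Ω* ∈ C³`,
  `DG⁺(Ω*)[Ω*′] = −½Ω*′` pointwise, `Ω*′ ∈ E⁺₀` (even, weighted `H¹`, zero mass) and `Ω*′ ≢ 0` — modulo EXACTLY the hypotheses of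
  `exists_isCentre_star` (centre datum `hc`, `Ω̄₁ ∈ C¹`, weighted residual `hG`, the linearised weak equation in the ball, `|Ω̄(X₀)| > (√2/8)·rEBR2`).
So the even row's P4 (ii) sentence reads henceforth «PO-2 = KERNEL (`translationMode_mem_evenEnergyClass_of_weakZero`), PO-3 = KERNEL, assembled for the
certified profile = `SheetRTranslationModeAssembly.translationMode_certified`»; what stays PAPER in P4 (ii) is PO-1 (weak = classical on `E⁺₀`) and the
transposed odd P-list ((P5) argument principle / Gohberg–Sigal for the EVEN Evans function — the even-class resolvent dictionary is not in the tree).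
[folklore] 1-D calculus, composition of tree theorems only; MODEL-support, no NS content.
-/

noncomputable section

namespace Summit.NavierStokesRegularity.OSWSelfSimilar
namespace SheetRTranslationModeAssembly

open _root_.MeasureTheory _root_.Set _root_.Filter Literature.Analysis.Fourier SheetRWeakProfilePV
  SheetRProfileRegularity SheetRTimeShiftModeEnergy SheetRTimeShiftModeAssembly
open scoped Real Topology ENNReal ContDiff

section Shape

variable {a ν L : ℝ} {Ω : ℝ → ℝ}

/-! ### §1 The strong-zero data shape -/

/-- **(PO-2) ∧ (PO-3) OF THE EVEN HALF, ASSEMBLED (covariant gauge).** Let `Ω ∈ C²` be an ODD energy-class strong zero of the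
sheet-ℝ profile map — `Ω(X) + ½XΩ′(X) + a·𝒰Ω(X)·Ω′(X) − HΩ(X)·Ω(X) − ν·Ω″(X) = 0` at every `X`, `∫(L²+ξ²)Ω² < ∞`,
`∫(L²+ξ²)Ω′² < ∞` (`ν > 0`, `L > 0`). Then the translation mode `v = Ω′` satisfies, at every `X`,
`v + ½X·v′ + a·(HΩ·Ω′ + 𝒰Ω·v′) − Hv·Ω − HΩ·v − ν·v″ = −½·v(X)` — `σ = ½` is an exact eigenvalue of `−DG⁺(Ω)` in the
translation-covariant gauge (`𝒰_{Ω′} = HΩ`; `SheetRTranslationMode.linearised_translationMode_covariant` with its decay hypotheses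
DISCHARGED by `decayClass`) — AND `v` is even with `∫(L²+ξ²)v² < ∞`, `∫(L²+ξ²)v′² < ∞`, `∫v = 0`, i.e. `v ∈ E⁺₀`
(`translationMode_mem_evenEnergyClass`). MODEL statement (1-D viscous gCLM sheet); not NS; nothing asserts that such an `Ω`
exists. [folklore] -/
theorem translationMode_eigen_and_energy {v : ℝ → ℝ} (hL : 0 < L) (hν : 0 < ν) (hΩ : ContDiff ℝ 2 Ω)
    (hodd : ∀ y, Ω (-y) = -Ω y)
    (hw0 : Integrable fun y => (L ^ 2 + y ^ 2) * Ω y ^ 2)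
    (hw1 : Integrable fun y => (L ^ 2 + y ^ 2) * deriv Ω y ^ 2)
    (hG : ∀ X, Ω X + 1 / 2 * X * deriv Ω X + a * (∫ s in (0 : ℝ)..X, hilbertTransform Ω s) * deriv Ω X
      - hilbertTransform Ω X * Ω X - ν * iteratedDeriv 2 Ω X = 0)
    (hv : v = deriv Ω) :
    (∀ X, v X + 1 / 2 * X * deriv v X
        + a * (hilbertTransform Ω X * deriv Ω X + (∫ s in (0 : ℝ)..X, hilbertTransform Ω s) * deriv v X)
        - hilbertTransform v X * Ω X - hilbertTransform Ω X * v X - ν * iteratedDeriv 2 v X = -(1 / 2) * v X) ∧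
      (∀ y, v (-y) = v y) ∧ (Integrable fun y => (L ^ 2 + y ^ 2) * v y ^ 2) ∧
      (Integrable fun y => (L ^ 2 + y ^ 2) * deriv v y ^ 2) ∧ ∫ y, v y = 0 := by
  obtain ⟨hΩ3, hΩi, -, ⟨M, hM⟩, ⟨C, hC⟩⟩ := decayClass hL hν hΩ hodd hw0 hw1 hG
  obtain ⟨he, h1, h2, hm⟩ := translationMode_mem_evenEnergyClass hL hν hΩ hodd hw0 hw1 hG
  subst hv
  exact ⟨SheetRTranslationMode.linearised_translationMode_covariant hΩ3 hΩi hM hC hG rfl, he, h1, h2, hm⟩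

/-- **The pinned-gauge companion.** Under the same hypotheses, spelling the perturbation velocity of the even mode with the
certificate's odd-class formula `𝒰v(X) = ∫₀^X H[v]` (`= HΩ(X) − HΩ(0)`): `v + ½X·v′ + a·(𝒰v·Ω′ + 𝒰Ω·v′) − Hv·Ω − HΩ·v − ν·v″
= −(½ + a·HΩ(0))·v` pointwise (`SheetRTranslationMode.linearised_translationMode_pinned`, decay class discharged) — the
non-covariant artefact of DESIGN (D2) (`1.28974` at the centre of record). MODEL statement; not NS. [folklore] -/
theorem translationMode_eigen_pinned {v : ℝ → ℝ} (hL : 0 < L) (hν : 0 < ν) (hΩ : ContDiff ℝ 2 Ω)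
    (hodd : ∀ y, Ω (-y) = -Ω y)
    (hw0 : Integrable fun y => (L ^ 2 + y ^ 2) * Ω y ^ 2)
    (hw1 : Integrable fun y => (L ^ 2 + y ^ 2) * deriv Ω y ^ 2)
    (hG : ∀ X, Ω X + 1 / 2 * X * deriv Ω X + a * (∫ s in (0 : ℝ)..X, hilbertTransform Ω s) * deriv Ω X
      - hilbertTransform Ω X * Ω X - ν * iteratedDeriv 2 Ω X = 0)
    (hv : v = deriv Ω) (X : ℝ) :
    v X + 1 / 2 * X * deriv v X
      + a * ((∫ s in (0 : ℝ)..X, hilbertTransform v s) * deriv Ω X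
        + (∫ s in (0 : ℝ)..X, hilbertTransform Ω s) * deriv v X)
      - hilbertTransform v X * Ω X - hilbertTransform Ω X * v X - ν * iteratedDeriv 2 v X
      = -(1 / 2 + a * hilbertTransform Ω 0) * v X := by
  obtain ⟨hΩ3, hΩi, -, ⟨M, hM⟩, ⟨C, hC⟩⟩ := decayClass hL hν hΩ hodd hw0 hw1 hG
  exact SheetRTranslationMode.linearised_translationMode_pinned hΩ3 hΩi hM hC hG hv X

/-! ### §2 The certificate's literal data shape: the `E`-weak zero `Ω = ∫₀Ω₁` -/

/-- **(PO-2) ∧ (PO-3) on the `E`-weak zero.** Let `Ω = ∫₀^ξ Ω₁` be ODD with `Ω₁` a.e.-strongly measurable, `∫(L²+ξ²)Ω² < ∞`,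
`∫(L²+ξ²)Ω₁² < ∞` (`Ω ∈ E`, `L > 0`), `ν > 0`, and assume the weak profile equation (W) of `SheetRWeakToStrong` against all `C_c^∞`
tests. Then `Ω ∈ C³` is a pointwise zero of the profile map, and the translation mode `v = Ω′` is an eigenvector of `−DG⁺(Ω)` for
`σ = ½` in the covariant gauge (pointwise identity) lying in `E⁺₀` (even, `∫(L²+ξ²)(v² + v′²) < ∞`, `∫v = 0`). Composition of
`timeShiftMode_eigen_and_energy_of_weakZero` (bridge: `C³` + strong zero), `translationMode_mem_evenEnergyClass_of_weakZero` (the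
`E`-datum on `Ω′`) and §1. MODEL statement; no profile is asserted to exist. [folklore] -/
theorem translationMode_eigen_and_energy_of_weakZero {Ω₁ v : ℝ → ℝ} (hL : 0 < L) (hν : 0 < ν)
    (hΩ : ∀ x, Ω x = ∫ s in (0 : ℝ)..x, Ω₁ s) (hodd : ∀ y, Ω (-y) = -Ω y)
    (hΩ₁m : AEStronglyMeasurable Ω₁ volume)
    (hwΩ : Integrable fun y => (L ^ 2 + y ^ 2) * Ω y ^ 2) (hwΩ₁ : Integrable fun y => (L ^ 2 + y ^ 2) * Ω₁ y ^ 2)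
    (hweak : ∀ ψ : ℝ → ℝ, ContDiff ℝ ∞ ψ → HasCompactSupport ψ →
      (∫ x, (Ω x + 1 / 2 * x * Ω₁ x + a * (∫ s in (0 : ℝ)..x, hilbertTransform Ω s) * Ω₁ x
        - hilbertTransform Ω x * Ω x) * ψ x) + ν * ∫ x, Ω₁ x * deriv ψ x = 0)
    (hv : v = deriv Ω) :
    (ContDiff ℝ 3 Ω ∧ ∀ X : ℝ, Ω X + 1 / 2 * X * deriv Ω X
      + a * (∫ s in (0 : ℝ)..X, hilbertTransform Ω s) * deriv Ω X
      - hilbertTransform Ω X * Ω X - ν * iteratedDeriv 2 Ω X = 0) ∧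
    (∀ X, v X + 1 / 2 * X * deriv v X
        + a * (hilbertTransform Ω X * deriv Ω X + (∫ s in (0 : ℝ)..X, hilbertTransform Ω s) * deriv v X)
        - hilbertTransform v X * Ω X - hilbertTransform Ω X * v X - ν * iteratedDeriv 2 v X = -(1 / 2) * v X) ∧
      (∀ y, v (-y) = v y) ∧ (Integrable fun y => (L ^ 2 + y ^ 2) * v y ^ 2) ∧
      (Integrable fun y => (L ^ 2 + y ^ 2) * deriv v y ^ 2) ∧ ∫ y, v y = 0 := by
  obtain ⟨⟨hΩ3, hG⟩, -⟩ :=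
    timeShiftMode_eigen_and_energy_of_weakZero hL hν hΩ hodd hΩ₁m hwΩ hwΩ₁ hweak rfl
  obtain ⟨-, hw1, -, -⟩ := translationMode_mem_evenEnergyClass_of_weakZero hL hν hΩ hodd hΩ₁m hwΩ hwΩ₁ hweak
  have hC2 : ContDiff ℝ 2 Ω := hΩ3.of_le (by norm_num)
  exact ⟨⟨hΩ3, hG⟩, translationMode_eigen_and_energy hL hν hC2 hodd hwΩ hw1 hG hv⟩

/-- **The translation mode of a non-trivial `E`-weak zero is non-trivial.** Same hypotheses; if `Ω(X₀) ≠ 0` for some `X₀`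
then `Ω′(X) ≠ 0` for some `X` (`translationMode_ne_zero`: `Ω′ ≡ 0` and `Ω` odd force `Ω ≡ 0`), so the identity of
`translationMode_eigen_and_energy_of_weakZero` exhibits a genuine eigenvector. MODEL-support calculus. [folklore] -/
theorem translationMode_ne_zero_of_weakZero {Ω₁ : ℝ → ℝ} (hL : 0 < L) (hν : 0 < ν)
    (hΩ : ∀ x, Ω x = ∫ s in (0 : ℝ)..x, Ω₁ s) (hodd : ∀ y, Ω (-y) = -Ω y)
    (hΩ₁m : AEStronglyMeasurable Ω₁ volume)
    (hwΩ : Integrable fun y => (L ^ 2 + y ^ 2) * Ω y ^ 2) (hwΩ₁ : Integrable fun y => (L ^ 2 + y ^ 2) * Ω₁ y ^ 2)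
    (hweak : ∀ ψ : ℝ → ℝ, ContDiff ℝ ∞ ψ → HasCompactSupport ψ →
      (∫ x, (Ω x + 1 / 2 * x * Ω₁ x + a * (∫ s in (0 : ℝ)..x, hilbertTransform Ω s) * Ω₁ x
        - hilbertTransform Ω x * Ω x) * ψ x) + ν * ∫ x, Ω₁ x * deriv ψ x = 0)
    {X₀ : ℝ} (hX₀ : Ω X₀ ≠ 0) : ∃ X, deriv Ω X ≠ 0 := by
  obtain ⟨⟨hΩ3, -⟩, -⟩ :=
    timeShiftMode_eigen_and_energy_of_weakZero hL hν hΩ hodd hΩ₁m hwΩ hwΩ₁ hweak rfl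
  exact translationMode_ne_zero (hΩ3.of_le (by norm_num)) hodd hX₀

end Shape

/-! ### §3 THE certified profile of the Z3-SR chain (`a = 1/5`, `ν = 1`, `L = 8`) -/

section Certified

open _root_.Metric SheetREnergySpace SheetRLinearisedTests SheetRLinearisedFormBounds SheetRSolutionOperator
  SheetRAssemblyOperators SheetRCertificateAssembly SheetRCertificateAssemblyB SheetRSpectrumCertifiedProfile
  CertificateViscousSheetR

variable {Ω Ω₁ : ℝ → ℝ} {H₀ : ℝ} (hc : IsCentre 8 Ω Ω₁ H₀) (hΩ₁ : ContDiff ℝ 1 Ω₁)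
  (hG : Integrable fun y => ((8:ℝ) ^ 2 + y ^ 2) * (Ω y + 1 / 2 * y * Ω₁ y + 1 / 5 * (∫ s in (0 : ℝ)..y, hilbertTransform Ω s) * Ω₁ y
    - hilbertTransform Ω y * Ω y - deriv Ω₁ y) ^ 2)
  (δ : Esp 8 eight_pos) (hball : δ ∈ closedBall (0 : Esp 8 eight_pos) (rEBR2 : ℝ))
  (hlin : ∀ v v₁ : ℝ → ℝ, IsCompactTest v v₁ →
    linForm 8 (drift (1 / 5) Ω) (potential 8 4 Ω) (prim (der δ)) (der δ) v v₁ =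
      ∫ y, ((8:ℝ) ^ 2 + y ^ 2) * ((PopFun 8 4 (1 / 5) Ω Ω₁ δ y
        - (Ω y + 1 / 2 * y * Ω₁ y + 1 / 5 * (∫ s in (0 : ℝ)..y, hilbertTransform Ω s) * Ω₁ y - hilbertTransform Ω y * Ω y - deriv Ω₁ y)
        - QFun 8 (1 / 5) δ δ y) * v y))
  {X₀ : ℝ} (hX₀ : Real.sqrt 2 / 8 * (rEBR2 : ℝ) < |Ω X₀|)

include hc hΩ₁ hG hball hlin hX₀ in
/-- **(PO-2) ∧ (PO-3) FOR THE CERTIFIED PROFILE.** For every `δ` in the `rEBR2`-ball solving the linearised weak equation at the centre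
(the output of `SheetRCertificateAssemblyB.existsUnique_weakSolutionB`; hypotheses exactly those of
`SheetRSpectrumCertifiedProfile.exists_isCentre_star`: the centre datum `hc : IsCentre 8 Ω̄ Ω̄₁ H₀`, `Ω̄₁ ∈ C¹`, the weighted residual `hG`, `hlin`,
`|Ω̄(X₀)| > (√2/8)·rEBR2`), the profile `Ω* := Ω̄ + prim (der δ)` is a centre (`IsCentre 8 Ω* Ω*₁ H*`), lies in `C³`, and its translation
mode `Ω*′` satisfies: `Ω*′ + ½X·Ω*″ + (1/5)·(HΩ*·Ω*′ + 𝒰Ω*·Ω*″) − H[Ω*′]·Ω* − HΩ*·Ω*′ − Ω*‴ = −½·Ω*′` at every `X` (`σ = ½` is an exact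
eigenvalue of `−DG⁺(Ω*)`, covariant gauge), `Ω*′` is EVEN with `∫(64+ξ²)Ω*′² < ∞`, `∫(64+ξ²)Ω*″² < ∞`, `∫Ω*′ = 0` (`Ω*′ ∈ E⁺₀`), and `Ω*′ ≢ 0`.
This is the kernel form of the even row's PO-2/PO-3 for THE profile the existence row certifies; with the S2⁺ winding word it is what pins
the one zero of `E⁺*` in `D⁺` to `σ = ½` (the identification itself — (P5)/Gohberg–Sigal for the even Evans function — stays PAPER).
MODEL statement; not NS; no number of record moves. [folklore] -/
theorem translationMode_certified :
    ∃ (Ωs₁ : ℝ → ℝ) (Hs : ℝ), IsCentre 8 (fun y => Ω y + prim (der δ) y) Ωs₁ Hs ∧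
      ContDiff ℝ 3 (fun y => Ω y + prim (der δ) y) ∧
      (∀ X, deriv (fun y => Ω y + prim (der δ) y) X
          + 1 / 2 * X * deriv (deriv (fun y => Ω y + prim (der δ) y)) X
          + 1 / 5 * (hilbertTransform (fun y => Ω y + prim (der δ) y) X * deriv (fun y => Ω y + prim (der δ) y) X
            + (∫ s in (0 : ℝ)..X, hilbertTransform (fun y => Ω y + prim (der δ) y) s)
              * deriv (deriv (fun y => Ω y + prim (der δ) y)) X)
          - hilbertTransform (deriv (fun y => Ω y + prim (der δ) y)) X * (Ω X + prim (der δ) X)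
          - hilbertTransform (fun y => Ω y + prim (der δ) y) X * deriv (fun y => Ω y + prim (der δ) y) X
          - 1 * iteratedDeriv 2 (deriv (fun y => Ω y + prim (der δ) y)) X
        = -(1 / 2) * deriv (fun y => Ω y + prim (der δ) y) X) ∧
      (∀ y, deriv (fun y => Ω y + prim (der δ) y) (-y) = deriv (fun y => Ω y + prim (der δ) y) y) ∧
      (Integrable fun y => ((8:ℝ) ^ 2 + y ^ 2) * deriv (fun y => Ω y + prim (der δ) y) y ^ 2) ∧
      (Integrable fun y => ((8:ℝ) ^ 2 + y ^ 2) * deriv (deriv (fun y => Ω y + prim (der δ) y)) y ^ 2) ∧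
      (∫ y, deriv (fun y => Ω y + prim (der δ) y) y = 0) ∧
      ∃ X, deriv (fun y => Ω y + prim (der δ) y) X ≠ 0 := by
  obtain ⟨Ωs₁, Hs, hcs, hweak, hne⟩ := exists_isCentre_star hc hΩ₁ hG δ hball hlin hX₀
  set Ωs : ℝ → ℝ := fun y => Ω y + prim (der δ) y with hΩs
  have hweak1 : ∀ ψ : ℝ → ℝ, ContDiff ℝ ∞ ψ → HasCompactSupport ψ →
      (∫ x, (Ωs x + 1 / 2 * x * Ωs₁ x + 1 / 5 * (∫ s in (0 : ℝ)..x, hilbertTransform Ωs s) * Ωs₁ x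
        - hilbertTransform Ωs x * Ωs x) * ψ x) + 1 * ∫ x, Ωs₁ x * deriv ψ x = 0 := fun ψ hψ hψc => by
    rw [one_mul]; exact hweak ψ hψ hψc
  obtain ⟨⟨hC3, -⟩, hcov, he, h1, h2, hm⟩ :=
    translationMode_eigen_and_energy_of_weakZero (a := 1 / 5) (L := 8) (ν := 1) eight_pos one_pos hcs.primitive hcs.odd
      hcs.measurable hcs.weight₀ hcs.weight₁ hweak1 rfl
  exact ⟨Ωs₁, Hs, hcs, hC3, hcov, he, h1, h2, hm, translationMode_ne_zero (hC3.of_le (by norm_num)) hcs.odd hne⟩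

end Certified

end SheetRTranslationModeAssembly
end Summit.NavierStokesRegularity.OSWSelfSimilar

end
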